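import Mathlib
import HarnessLib
import Literature.MathematicalPhysics.QuantumLattice.HubbardGrandCanonicalDensity
import Summits.HubbardSuperconductivity.HubbardSuperconductivity.Theorems.WeakCouplingBCSWcbcsBcsConstructionEnergyDensityLimit

/-!
# The grand-canonical ground-state density of the 2D Hubbard torus converges at almost every chemical potential
# (crux `WcbcsBcsConstruction`, stmt-HubbardSuperconductivity-2010, line `ladder-scale-certified-chain`, lead c4 — reusable form of (T3))

Write `E_L(U,μ) = E₀(hubbardTorusWith 2 (L+1) 1 U μ)` and `n_L(U,μ) = Re ω₀[hubbardTorusWith 2 (L+1) 1 U μ](N)/(L+1)²` (tracial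
grand-canonical ground-state density).  For EVERY real coupling `U` (no sign, no smallness):

* `wcbcs_gcEnergyDensity_antitone` — the limiting energy density `e(U,μ) = lim_L E_L(U,μ)/(L+1)²` (it exists for all `U, μ`:
  `stub_torusGcEnergyDensityLimit`, p76736; written with `limUnder`) is antitone in `μ`;
* `stub_aeDensityConvergence` / `wcbcs_ae_tendsto_gcDensity` — for Lebesgue-almost every `μ`, `n_L(U,μ) → -∂_μ e(U,μ)` (an antitone function
  is differentiable a.e., `Monotone.ae_differentiableAt`; Griffiths' lemma `tendsto_gcDensity_of_hasDerivAt` at such `μ`);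
* `wcbcs_exists_mem_Ioo_tendsto_gcDensity` — hence every open interval of chemical potentials contains a `μ` at which the density
  converges, with limit between `liminf` and `limsup` trivially, so any a-priori brackets on the limit points transfer to the limit.

This is the window-free, bracket-free core of stub (T3) `stub_aeDensityMatching` (p142962), recorded for the sibling cruxes whose density
clause has `δ` existential AFTER `∀ U` (stmt-1740 `CwChiralConstruction`) or which become so after a thin restatement (stmt-2010): for them
density matching needs NO equation-of-state regularity.  No definitions.  References: R. B. Griffiths, J. Math. Phys. 5 (1964) 1215;
T. Koma, H. Tasaki, J. Stat. Phys. 76 (1994) 745, §1; H. Lebesgue (monotone functions are differentiable a.e.), via Mathlib.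
-/

noncomputable section

-- the tree's namespace `Summit.<Summit>.<Problem>.Theorems` repeats the summit name by design (D-0017)
set_option linter.dupNamespace false

namespace Summit.HubbardSuperconductivity.HubbardSuperconductivity.Theorems

open Literature.MathematicalPhysics.QuantumLattice Literature.Probability.LatticeModels MeasureTheory Matrix Filter
open scoped Topology

/-- **The limiting grand-canonical energy density exists and is the `limUnder`**: for every `U, ν`,
`E_L(U,ν)/(L+1)² → e(U,ν) := limUnder_L E_L(U,ν)/(L+1)²`. [folklore] -/
theorem wcbcs_tendsto_gcEnergyDensity_limUnder (U ν : ℝ) :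
    Tendsto (fun L : ℕ => (hubbardTorusWith 2 (L + 1) 1 U ν).groundEnergy / ((L + 1 : ℕ) : ℝ) ^ 2) atTop
      (𝓝 (limUnder atTop (fun L : ℕ => (hubbardTorusWith 2 (L + 1) 1 U ν).groundEnergy / ((L + 1 : ℕ) : ℝ) ^ 2))) :=
  tendsto_nhds_limUnder (stub_torusGcEnergyDensityLimit U ν)

/-- **The limiting grand-canonical energy density is antitone in the chemical potential** (for every real `U`): the finite-volume
energies are non-increasing in `μ` (`groundEnergy_torus_sub_mem_Icc_of_le`) and the limit preserves `≤`. [folklore] -/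
theorem wcbcs_gcEnergyDensity_antitone (U : ℝ) :
    Antitone (fun ν : ℝ => limUnder atTop (fun L : ℕ => (hubbardTorusWith 2 (L + 1) 1 U ν).groundEnergy /
      ((L + 1 : ℕ) : ℝ) ^ 2)) := by
  intro ν ν' hνν'
  refine le_of_tendsto_of_tendsto' (wcbcs_tendsto_gcEnergyDensity_limUnder U ν')
    (wcbcs_tendsto_gcEnergyDensity_limUnder U ν) fun L => ?_
  have hV : (0 : ℝ) < ((L + 1 : ℕ) : ℝ) ^ 2 := by positivity
  refine div_le_div_of_nonneg_right ?_ hV.le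
  have h0 := (groundEnergy_torus_sub_mem_Icc_of_le (L + 1) 1 U hνν').1
  linarith

/-- **The grand-canonical density converges at almost every chemical potential** (registered stub `stub_aeDensityConvergence` of crux
stmt-HubbardSuperconductivity-2010): for every real `U`, for Lebesgue-a.e. `μ`, `n_L(U,μ) → -∂_μ e(U,μ)` where `e(U,·)` is the limiting
energy density (antitone ⇒ differentiable a.e.; Griffiths' lemma at each differentiability point). [cite: KomaTasaki1994, §1] -/
theorem stub_aeDensityConvergence :
    ∀ U : ℝ, ∀ᵐ μ : ℝ, Tendsto (fun L : ℕ => ((hubbardTorusWith 2 (L + 1) 1 U μ).groundStateFunctional totalNumber).re / ((L + 1 : ℕ) : ℝ) ^ 2) atTop (𝓝 (-deriv (fun ν : ℝ => limUnder atTop (fun L : ℕ => (hubbardTorusWith 2 (L + 1) 1 U ν).groundEnergy / ((L + 1 : ℕ) : ℝ) ^ 2)) μ)) := by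
  intro U
  have hanti := wcbcs_gcEnergyDensity_antitone U
  filter_upwards [hanti.neg.ae_differentiableAt] with μ hμ
  have hdiff := (differentiableAt_neg_iff
    (f := fun ν : ℝ => limUnder atTop (fun L : ℕ => (hubbardTorusWith 2 (L + 1) 1 U ν).groundEnergy /
      ((L + 1 : ℕ) : ℝ) ^ 2))).1 hμ
  exact tendsto_gcDensity_of_hasDerivAt 1 U μ
    (Eventually.of_forall (wcbcs_tendsto_gcEnergyDensity_limUnder U)) hdiff.hasDerivAt

/-- Short name for `stub_aeDensityConvergence`. [cite: KomaTasaki1994, §1] -/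
theorem wcbcs_ae_tendsto_gcDensity (U : ℝ) :
    ∀ᵐ μ : ℝ, Tendsto (fun L : ℕ => ((hubbardTorusWith 2 (L + 1) 1 U μ).groundStateFunctional
      totalNumber).re / ((L + 1 : ℕ) : ℝ) ^ 2) atTop
      (𝓝 (-deriv (fun ν : ℝ => limUnder atTop (fun L : ℕ => (hubbardTorusWith 2 (L + 1) 1 U ν).groundEnergy /
        ((L + 1 : ℕ) : ℝ) ^ 2)) μ)) :=
  stub_aeDensityConvergence U

/-- **Every open interval of chemical potentials contains a point of density convergence** (for every real `U`): there are
`μ ∈ (a, b)` and `ρ` with `n_L(U,μ) → ρ`; moreover `ρ` lies between the `liminf` and the `limsup` (both equal it), so a-priori brackets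
on the limit points transfer to `ρ`. [cite: KomaTasaki1994, §1] -/
theorem wcbcs_exists_mem_Ioo_tendsto_gcDensity (U : ℝ) {a b : ℝ} (hab : a < b) :
    ∃ μ ∈ Set.Ioo a b, ∃ ρ : ℝ,
      Tendsto (fun L : ℕ => ((hubbardTorusWith 2 (L + 1) 1 U μ).groundStateFunctional
        totalNumber).re / ((L + 1 : ℕ) : ℝ) ^ 2) atTop (𝓝 ρ) ∧
      liminf (fun L : ℕ => ((hubbardTorusWith 2 (L + 1) 1 U μ).groundStateFunctional
        totalNumber).re / ((L + 1 : ℕ) : ℝ) ^ 2) atTop = ρ ∧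
      limsup (fun L : ℕ => ((hubbardTorusWith 2 (L + 1) 1 U μ).groundStateFunctional
        totalNumber).re / ((L + 1 : ℕ) : ℝ) ^ 2) atTop = ρ := by
  have hae := wcbcs_ae_tendsto_gcDensity U
  by_contra h
  push Not at h
  have hsub : Set.Ioo a b ⊆ {μ | ¬ Tendsto (fun L : ℕ => ((hubbardTorusWith 2 (L + 1) 1 U μ).groundStateFunctional
      totalNumber).re / ((L + 1 : ℕ) : ℝ) ^ 2) atTop
      (𝓝 (-deriv (fun ν : ℝ => limUnder atTop (fun L : ℕ => (hubbardTorusWith 2 (L + 1) 1 U ν).groundEnergy /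
        ((L + 1 : ℕ) : ℝ) ^ 2)) μ))} := by
    intro μ hμ hT
    exact h μ hμ _ hT hT.liminf_eq hT.limsup_eq
  have h0 : volume (Set.Ioo a b) = 0 := measure_mono_null hsub (ae_iff.1 hae)
  rw [Real.volume_Ioo, ENNReal.ofReal_eq_zero] at h0
  linarith

end Summit.HubbardSuperconductivity.HubbardSuperconductivity.Theorems

end
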